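import Summits.SmoothPoincare4.SmoothPoincare4.Theses.VerlindeRLinks
import Literature.Topology.FourManifolds.RLinkSphereHomotopySphereProofs

/-!
# `SmoothPoincare4` ⇒ every R-link sphere is standard

Helper for the line `sphere_split` of the crux `VrlSliceRigidity` (route VerlindeRLinks): the
recognition stub `stub_sliceSphereStandard` ("slice components ⇒ every closed manifold `Σ_L` of
the R-link `L` is diffeomorphic to `S⁴`") is an open problem, but it is implied outright by the
summit statement `SmoothPoincare4`, with no sliceness hypothesis at all: a Hausdorff, second
countable smooth `X` with `IsRLinkSphere X L` is a homotopy `4`-sphere by the PROVED tree theorem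
`Literature.Topology.FourManifolds.IsRLinkSphere.nonempty_homotopyEquiv_sphere_holds`
(Gompf–Scharlemann–Thompson 2010, §9: "a simply-connected … homology `4`-sphere, hence a homotopy
`4`-sphere"), and `SmoothPoincare4` — definitionally
`∀ M [TopologicalSpace M] [T2Space M] [SecondCountableTopology M],
HomotopyEquiv.NonemptyDiffeomorphSphere M 4` — turns the homotopy equivalence into a
diffeomorphism for the given atlas.  Pure logic over the definitions (intro; obtain; exact), as in
the route's `closes`.
-/

noncomputable section

set_option linter.dupNamespace false

namespace Summit.SmoothPoincare4.SmoothPoincare4.Theorems.VrlSliceRigidity.SphereSplit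

open scoped Manifold ContDiff Topology
open Set Function Literature.Topology.FourManifolds

/-- Local notation: `𝔼 n` is the model Euclidean space `EuclideanSpace ℝ (Fin n)`. -/
local notation "𝔼 " n:arg => EuclideanSpace ℝ (Fin n)

/-- Local notation: `𝕊 n` is the unit sphere in `EuclideanSpace ℝ (Fin (n + 1))`. -/
local notation "𝕊 " n:arg => (Metric.sphere (0 : EuclideanSpace ℝ (Fin (n + 1))) 1)

/-- **`SmoothPoincare4` ⇒ every R-link sphere is diffeomorphic to `S⁴`.**  Under the smooth
`4`-dimensional Poincaré conjecture, every Hausdorff, second countable smooth `4`-manifold `X`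
carrying the handle decomposition `0h ∪ (2-handles along L) ∪ n·(3-handles) ∪ 4h` of a framed link
`L` (`IsRLinkSphere X L`) is diffeomorphic to the round sphere: `X ≃ₕ S⁴` by
`IsRLinkSphere.nonempty_homotopyEquiv_sphere_holds` (Gompf–Scharlemann–Thompson 2010, §9), and the
conjecture, unfolded to Mathlib's `ContinuousMap.HomotopyEquiv.NonemptyDiffeomorphSphere X 4`,
upgrades the homotopy equivalence to a diffeomorphism.  In particular `SmoothPoincare4` implies the
stub `stub_sliceSphereStandard` of the line `sphere_split` (drop the sliceness hypotheses). -/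
theorem helper_sliceSphereStandard_of_spc4 : SmoothPoincare4 → ∀ (n : ℕ) (L : FramedLink (Fin n)) (X : Type) [TopologicalSpace X] [T2Space X] [SecondCountableTopology X] [ChartedSpace (𝔼 4) X] [IsManifold (𝓡 4) ∞ X], IsRLinkSphere X L → Nonempty (X ≃ₘ⟮𝓡 4, 𝓡 4⟯ 𝕊 4) := by
  intro hS n L X _ _ _ _ _ hX
  obtain ⟨e⟩ := IsRLinkSphere.nonempty_homotopyEquiv_sphere_holds n L X hX
  exact hS X ‹_› ‹_› e

end Summit.SmoothPoincare4.SmoothPoincare4.Theorems.VrlSliceRigidity.SphereSplit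

end
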